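import Mathlib
import HarnessLib
import Summits.QuantumFields.QCD.Theses.NestedDissectionSea
import Literature.MathematicalPhysics.QuantumFieldTheory.QuasiLocalGaugePerturbationWilson
import Literature.MathematicalPhysics.QuantumFieldTheory.BlockScaleEffectivePerturbation

/-!
# Sketch — crux-ideate `stmt-QuantumFields-13897` (`RobustYangMills`), ideator 2, round 1

First lemmas of the two crux idea cards filed by this seat (signatures elaborate; proofs are not
required at the ideation stage — `sorry`):

* card `local-ac-open-certificate`: `local_oscillation` (changing the links of `n` blocks moves the
  total perturbation by at most `2ηn`, uniformly in the lattice spacing, the volume and the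
  configuration) and its DLR consequence `conditional_expectation_sandwich` (two-sided,
  `k`-uniform bound on conditional expectations of non-negative local functionals: the cone is
  LOCALLY ABSOLUTELY CONTINUOUS with respect to Wilson's theory);
* card `soft-absorption-balaban-cone`: `soft_absorption_holomorphic` (integrating the bounded,
  merely measurable spectator `e^{-β S_W - W}` against a kernel holomorphic in a complex block-field
  parameter gives a holomorphic function — roughness of `W` is invisible after soft conditioning)
  and `re_weighted_average_lower` (the soft-conditioned average of a positive bounded spectator
  under complex weights of unit mass and small negative part stays away from `0`, so its logarithm
  — the absorbed block-scale perturbation — is defined and `O(η)` on a `W`-independent domain).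
-/

namespace Summit.QuantumFields.QCD.Cruxes.RobustYangMills.Ideator2

open Literature.MathematicalPhysics.QuantumFieldTheory Literature.MathematicalPhysics.QuantumLattice
open MeasureTheory Finset

variable {G : Type*} [Group G] [MeasurableSpace G]

/-- **Card 1, first lemma (local oscillation of a cone member).** If `‖W‖_{b,κ} ≤ η` with
`κ ≥ 0` and two configurations agree on every link outside the cubes of the blocks in `R`, then
`|W(U) - W(U')| ≤ 2 η |R|`: only polymers through a block of `R` can see the difference, and their
sup norms sum to at most `η` per block. Uniform in the torus side `N`, the block size `b` (hence in
the lattice spacing at fixed physical block scale) and the configurations. -/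
theorem local_oscillation {N : ℕ} [NeZero N] {b : ℕ}
    (W : QuasiLocalGaugePerturbation 4 N G b) {κ η : ℝ} (hκ : 0 ≤ κ) (hW : W.NormLE κ η)
    (R : Finset (Site 4 N)) (hR : R ⊆ blockCorners b) (U U' : GaugeConfig 4 N G)
    (hUU' : ∀ e : Edge 4 N, (∀ y ∈ R, e ∉ polymerEdges b {y}) → U e = U' e) :
    |W.total U - W.total U'| ≤ 2 * η * R.card := by
  sorry

/-- Glue an interior configuration `V` on the edge set `E` to an exterior configuration `Uext`. -/
def glue {N : ℕ} (E : Finset (Edge 4 N)) (V Uext : GaugeConfig 4 N G) : GaugeConfig 4 N G :=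
  fun e => if e ∈ E then V e else Uext e

variable [TopologicalSpace G] [IsTopologicalGroup G] [CompactSpace G] [BorelSpace G]

/-- **Card 1, DLR form (conditional expectation sandwich).** For the perturbed weight
`e^{-β S_W - W}` and ANY exterior configuration, the conditional expectation of a non-negative
functional of the links of the blocks `R` is within the factor `e^{4η|R|}` of the unperturbed
(Wilson) conditional expectation with the same exterior — uniformly in `N`, `b`, `β`, the exterior
and the functional. This is the `k`-uniform LOCAL ABSOLUTE CONTINUITY of the cone. -/
theorem conditional_expectation_sandwich {N : ℕ} [NeZero N] {b : ℕ} {n : ℕ}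
    (ρ : G →* Matrix (Fin n) (Fin n) ℂ) (β : ℝ)
    (W : QuasiLocalGaugePerturbation 4 N G b) {κ η : ℝ} (hκ : 0 ≤ κ) (hW : W.NormLE κ η)
    (R : Finset (Site 4 N)) (hR : R ⊆ blockCorners b) (Uext : GaugeConfig 4 N G)
    (F : GaugeConfig 4 N G → ℝ) (hF : ∀ U, 0 ≤ F U) (hFm : Measurable F) :
    let E : Finset (Edge 4 N) := R.biUnion fun y => polymerEdges b {y}
    let μ : Measure (GaugeConfig 4 N G) := Measure.pi fun _ : Edge 4 N => haarProbability G
    let w₀ : GaugeConfig 4 N G → ℝ := fun V => Real.exp (-β * wilsonAction ρ (glue E V Uext))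
    let w : GaugeConfig 4 N G → ℝ :=
      fun V => Real.exp (-β * wilsonAction ρ (glue E V Uext) - W.total (glue E V Uext))
    (∫ V, F (glue E V Uext) * w V ∂μ) / (∫ V, w V ∂μ) ≤
      Real.exp (4 * η * R.card) * ((∫ V, F (glue E V Uext) * w₀ V ∂μ) / (∫ V, w₀ V ∂μ)) := by
  sorry

/-- **Card 2, first lemma (soft absorption is holomorphic whatever the roughness of `W`).**
Integrating the bounded measurable spectator `e^{-β S_W(U) - W(U)}` against a kernel `K(z, U)`
that is holomorphic in a complex parameter `z` (a chart of the complexified block field; e.g. an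
analytic continuation of a product of group heat kernels centred at covariant block averages),
measurable in `U` and locally uniformly bounded, yields a holomorphic function of `z`. -/
theorem soft_absorption_holomorphic {N : ℕ} [NeZero N] {b n m : ℕ}
    (ρ : G →* Matrix (Fin n) (Fin n) ℂ) (β : ℝ) (W : QuasiLocalGaugePerturbation 4 N G b)
    (D : Set (Fin m → ℂ)) (hD : IsOpen D) (K : (Fin m → ℂ) → GaugeConfig 4 N G → ℂ)
    (hKd : ∀ U, DifferentiableOn ℂ (fun z => K z U) D) (hKm : ∀ z ∈ D, Measurable (K z))
    (hKb : ∃ M : ℝ, ∀ z ∈ D, ∀ U, ‖K z U‖ ≤ M) :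
    DifferentiableOn ℂ
      (fun z => ∫ U, K z U * ((Real.exp (-β * wilsonAction ρ U - W.total U) : ℝ) : ℂ)
        ∂(Measure.pi fun _ : Edge 4 N => haarProbability G)) D := by
  sorry

omit [Group G] [TopologicalSpace G] [IsTopologicalGroup G] [CompactSpace G] [BorelSpace G] in
/-- **Card 2, companion (the absorbed perturbation is defined and small on a `W`-independent
domain).** A complex-weighted average (weights of total mass `1`, negative real parts of mass
`≤ τ`) of a real spectator with values in `[m, M]`, `0 < m`, has real part `≥ m(1+τ) - Mτ`; for the
spectator `e^{-W} ∈ [e^{-η}, e^{η}]` this is positive as soon as `τ < e^{-η}/(e^{η} - e^{-η})`,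
a condition on the KERNEL (through `τ`), not on `W`. -/
theorem re_weighted_average_lower {X : Type*} [MeasurableSpace X] (μ : Measure X)
    (w : X → ℂ) (f : X → ℝ) (m M τ : ℝ) (hm : 0 < m) (hf : ∀ x, m ≤ f x ∧ f x ≤ M)
    (hfm : Measurable f) (hw : Integrable w μ) (h1 : ∫ x, w x ∂μ = 1)
    (hτ : ∫ x, max (-(w x).re) 0 ∂μ ≤ τ) :
    m * (1 + τ) - M * τ ≤ (∫ x, (f x : ℂ) * w x ∂μ).re := by
  sorry

end Summit.QuantumFields.QCD.Cruxes.RobustYangMills.Ideator2
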